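/-
Copyright (c) 2026. All rights reserved.
Released under Apache 2.0 license as described in the file LICENSE.
Authors: abc-iut cell, wave-3 discharge seat abc-iut-L6-d5 (proof-only).
-/
import Mathlib.CategoryTheory.Equivalence
import Literature.IUT.HodgeArakelov.RadialEnvironments
import HarnessLib

/-!
# [IUTchII] Example 1.7 (i)–(v): discharge census of the "one verifies immediately" clauses

S. Mochizuki, *Inter-universal Teichmüller theory II*, §1, Example 1.7 (i)–(v) and Remark 1.7.1, kurims
manuscript (Dec. 2020) pp. 32–35 (read on the page). PROOF-ONLY companion of abc-iut-L6-t1's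
`Literature/IUT/HodgeArakelov/RadialEnvironments.lean` (p404042), which types Example 1.7 as REAL
category theory over Mathlib. Per-item outcome of the wave-3 discharge census (plan/L6/DISCHARGE-L6.md §E2
vocabulary; node ids of plan/WAVE1-NODES.tsv):

* **IUTchII:Ex1.7(i)** — data only (`RadialEnvironment`, `copies`): nothing printed to prove. ALREADY.
* **IUTchII:Ex1.7(ii)** — "whose associated radial functor is clearly full [cf. our assumption that any two
  collections of radial data are isomorphic!] and essentially surjective, hence determines a
  [tautologically!] multiradial environment" (p. 33): ALREADY-PROVED by t1 (`Φmtz_full`, `Φmtz_essSurj`,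
  `multiradialization_isMultiradial`). Residual proved HERE: the "natural functor `ℛ → ℛ^mtz` [i.e., given
  by `R ↦ (R, Φ(R), Φ(R) ≅ Φ(R))`]" is a functor OVER `𝒞`, i.e. followed by `Φ^mtz` it is `Φ`
  (`toMtz_comp_Φmtz`).
* **IUTchII:Ex1.7(iii)** — "one verifies immediately that this multiradiality is, in fact, equivalent to the
  condition that every object `(R₁, R₂, α)` of `ℛ ×_𝒞 ℛ` be isomorphic to the object `(R₁, R₁, id)`" and
  "the switching functor `sw` preserves the isomorphism class of objects" (p. 34): ALREADY-PROVED by t1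
  (`multiradial_iff_iso_diagonal`, `sw_obj_iso`). Residuals proved HERE: the printed `sw : ℛ ×_𝒞 ℛ ⥲ ℛ ×_𝒞 ℛ`
  IS an equivalence — indeed an involution up to natural isomorphism (`nonempty_sw_comp_sw_iso`,
  `sw_isEquivalence`) — and the diagonal object "is manifestly left unchanged by the switching functor"
  (`sw_obj_diagonal`).
* **IUTchII:Ex1.7(iv)** — definitions (`RadialMorphism`, multiradially / uniradially / corically defined);
  "one may think of the notion of a corically defined `Ψ_ℛ` as a sort of special case of the notion of a
  multiradial `Ψ_ℛ`" ALREADY-PROVED (`isMultiradial_of_id`). Nothing further is printed as a claim.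
* **IUTchII:Ex1.7(v)** — "the multiradiality of `Ψ_ℛ` implies that one may lift these gluing isomorphisms
  in `𝒞` to gluing isomorphisms in `ℛ`" ALREADY-PROVED (`exists_lift_iso`; uniqueness up to non-faithfulness
  = Rmk 1.7.1 `lift_unique_of_faithful`). Residual proved HERE: "one may then apply `Ψ_ℛ` to these gluing
  isomorphisms in `ℛ` to obtain gluing isomorphisms of the output data of `Ψ_ℛ`" COMPATIBLY with the given
  identification of coric portions, via the 1-commutative square of (iv) (`exists_output_gluing`).

No definitions (the equivalence / involution are recorded as `Prop`s: `Functor.IsEquivalence`,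
`Nonempty (_ ≅ _)`); nothing here bears on [IUTchIII] Cor. 3.12 — Example 1.7 is elementary category
theory. Tag form [claim: Mochizuki2012, status: disputed] records that the SENTENCES are transcribed from
[IUTchII].
-/

namespace Literature.IUT.HodgeArakelov

namespace RadialEnvironment

open CategoryTheory

universe v u

variable (E : RadialEnvironment.{v, u})

/-! ## Example 1.7 (ii): the natural functor `ℛ → ℛ^mtz` lies over `𝒞` -/

/-- **IUTchII:Ex1.7(ii)** (kurims p. 33) "a natural functor `ℛ → ℛ^mtz` [i.e., given by the assignment
`R ↦ (R, Φ(R), Φ(R) ≅ Φ(R))`]" whose composite with the radial algorithm "`(R, C, α) ↦ C`" of the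
multiradialization is the original radial functor `Φ` — PROVED (on the nose).
[claim: Mochizuki2012, status: disputed] -/
theorem toMtz_comp_Φmtz : E.toMtz ⋙ E.Φmtz = E.Φ := rfl

/-! ## Example 1.7 (iii): the switching functor is an involutive equivalence fixing the diagonal -/

/-- **IUTchII:Ex1.7(iii)** (kurims p. 34) the diagonal object `(R₁, R₁, id : Φ(R₁) ≅ Φ(R₁))` "is manifestly
left unchanged by the switching functor" — PROVED (`sw (R, R, id) = (R, R, id⁻¹) = (R, R, id)`).
[claim: Mochizuki2012, status: disputed] -/
theorem sw_obj_diagonal (R : E.R) : E.sw.obj (E.diagonal R) = E.diagonal R := by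
  change Comma.mk R R (Groupoid.inv (𝟙 (E.Φ.obj R))) = Comma.mk R R (𝟙 (E.Φ.obj R))
  rw [Groupoid.inv_eq_inv, IsIso.inv_id]

/-- **IUTchII:Ex1.7(iii)** (kurims p. 34) `sw : ℛ ×_𝒞 ℛ ⥲ ℛ ×_𝒞 ℛ`, "`(R₁, R₂, α) ↦ (R₂, R₁, α⁻¹)`": applying it
twice is naturally isomorphic to the identity (`(α⁻¹)⁻¹ = α`) — PROVED.
[claim: Mochizuki2012, status: disputed] -/
theorem nonempty_sw_comp_sw_iso : Nonempty (E.sw ⋙ E.sw ≅ 𝟭 E.FiberSquare) := by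
  refine ⟨NatIso.ofComponents (fun X => Comma.isoMk (Iso.refl _) (Iso.refl _) ?_) ?_⟩
  · change E.Φ.map (𝟙 X.left) ≫ X.hom = Groupoid.inv (Groupoid.inv X.hom) ≫ E.Φ.map (𝟙 X.right)
    rw [Groupoid.inv_eq_inv, Groupoid.inv_eq_inv, IsIso.inv_inv, Functor.map_id, Functor.map_id,
      Category.id_comp, Category.comp_id]
  · intro X Y f
    ext
    · change f.left ≫ 𝟙 Y.left = 𝟙 X.left ≫ f.left
      rw [Category.comp_id, Category.id_comp]
    · change f.right ≫ 𝟙 Y.right = 𝟙 X.right ≫ f.right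
      rw [Category.comp_id, Category.id_comp]

/-- **IUTchII:Ex1.7(iii)** (kurims p. 34) the printed arrow `sw : ℛ ×_𝒞 ℛ ⥲ ℛ ×_𝒞 ℛ` IS an isomorphism of
categories in the sense of an equivalence (self-inverse up to the natural isomorphism above) — PROVED.
[claim: Mochizuki2012, status: disputed] -/
theorem sw_isEquivalence : E.sw.IsEquivalence := by
  obtain ⟨e⟩ := E.nonempty_sw_comp_sw_iso
  exact (CategoryTheory.Equivalence.mk E.sw E.sw e.symm e).isEquivalence_functor

/-! ## Example 1.7 (v): gluing isomorphisms of the OUTPUT data, compatibly with the coric identification -/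

/-- **IUTchII:Ex1.7(v)** (kurims p. 35) "if one implements this identification of the various coric portions
by means of various gluing isomorphisms in `𝒞`, then the multiradiality of `Ψ_ℛ` implies that one may lift
these gluing isomorphisms in `𝒞` to gluing isomorphisms in `ℛ`; one may then apply `Ψ_ℛ` to these gluing
isomorphisms in `ℛ` to obtain gluing isomorphisms of the output data of `Ψ_ℛ`" — PROVED, with the
compatibility the 1-commutative square `Φ† ∘ Ψ_ℛ ≅ Ψ_𝒞 ∘ Φ` of (iv) imposes: for a multiradially defined
`Ψ_ℛ` and a gluing isomorphism `β : Φ(R₁) ≅ Φ(R₂)` of coric portions there is a gluing isomorphism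
`f : R₁ ≅ R₂` over `β` whose image `Ψ_ℛ(f)` of output data lies, via `Φ†`, over `Ψ_𝒞(β)`.
[claim: Mochizuki2012, status: disputed] -/
theorem exists_output_gluing {F : RadialEnvironment.{v, u}} (Ψ : RadialMorphism E F)
    (h : Ψ.IsMultiradiallyDefined) {R₁ R₂ : E.R} (β : E.Φ.obj R₁ ≅ E.Φ.obj R₂) :
    ∃ f : R₁ ≅ R₂, E.Φ.mapIso f = β ∧
      F.Φ.mapIso (Ψ.ΨR.mapIso f) ≪≫ Ψ.comm.app R₂ = Ψ.comm.app R₁ ≪≫ Ψ.ΨC.mapIso β := by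
  obtain ⟨f, hf⟩ := E.exists_lift_iso h β
  refine ⟨f, hf, ?_⟩
  ext
  have nat := Ψ.comm.hom.naturality f.hom
  simp only [Functor.comp_map] at nat
  simp only [Iso.trans_hom, Functor.mapIso_hom, Iso.app_hom, ← hf]
  exact nat

/-- **IUTchII:Ex1.7(v)** with **IUTchII:Rmk1.7.1** (kurims p. 35): when `Φ` is moreover faithful ("up to an
indeterminacy arising from the extent that `Φ` fails to be faithful, such liftings are unique"), the
output gluing isomorphism over a given coric gluing `β` is uniquely determined — PROVED.
[claim: Mochizuki2012, status: disputed] -/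
theorem output_gluing_unique [E.Φ.Faithful] {F : RadialEnvironment.{v, u}} (Ψ : RadialMorphism E F)
    {R₁ R₂ : E.R} (β : E.Φ.obj R₁ ≅ E.Φ.obj R₂) (f g : R₁ ≅ R₂) (hf : E.Φ.mapIso f = β)
    (hg : E.Φ.mapIso g = β) : Ψ.ΨR.mapIso f = Ψ.ΨR.mapIso g := by
  rw [E.lift_unique_of_faithful f g (hf.trans hg.symm)]

end RadialEnvironment

end Literature.IUT.HodgeArakelov
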